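import Summits.ValiantsHypothesis.ValiantsHypothesis.Theorems.GrenetZeonDualUnipotentThreeHalvesHeavyTopWeightShadow

/-!
# `GrenetZeon.DualUnipotentThreeHalves` (stmt-ValiantsHypothesis-24318), R2 `HeavyTopLaw` — PORT of val-idea-27's
# `Cruxes/DualUnipotentThreeHalves/WeightShadow.lean` @9b27f785c669 (cards «graded-shadow» / «pluecker-gap»), part (P3): ★ K2 `irrThree_semistable` — MOR's `Irr₃` is Plücker-SEMISTABLE

VERBATIM PORT (desk RULING #313 / director R282 (3); writer val-port-4 g2; AUTHOR OF THE MATHEMATICS AND THE LEAN TEXT: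
val-idea-27 — every statement and proof below is idea-27's, byte-identical apart from the namespace
`…Theorems.GrenetZeon.WeightShadow` and added one-line docstrings where the source had none).  This file: the `Irr₃` weight lemmas (`irrThree_commutator`, `irrThree_commutator_sq_trace`, `conj_apply_eq_zero_of_mem_wtFilt`, `trace_comm_sq_eq_zero_of_wt`, `finrank_irrThreeSpace_le`, `trace_comm_irrE_sq`, `trace_comm_irrF_sq`, `irrThree_eq_zero_of_wt`) and K2 `irrThree_semistable` (`¬ PlUnstable irrThreeSpace`).

NOT ported (stay in `Cruxes/`): `stub_threeWeightLaw` (L4 = the law `ThreeWeightLaw`, research rung), the L1 appendix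
(`gradedCertificate` over four linear-algebra stubs), the K1c-refuted section.  HONEST LABEL: helper-currency port of an
ideator's SORRY-FREE lemmas; nothing here bears on R2 `HeavyTopLaw`, 24318, S3b or 8062 beyond what the Cruxes file already
said; `VP ≠ VNP` is NOT proved; no summit statement is proved here.  No named facts.
-/

noncomputable section

-- single-conjunct layout: Sub = Summit, duplicated namespace component intended
set_option linter.dupNamespace false

namespace Summit.ValiantsHypothesis.ValiantsHypothesis.Theorems.GrenetZeon.WeightShadow

open MvPolynomial Matrix
open scoped BigOperators
open Summit.ValiantsHypothesis.ValiantsHypothesis.Cruxes.TwoDimCoefficients.DimTwoCases (AffMat IsAffine)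
open Summit.ValiantsHypothesis.ValiantsHypothesis.Theorems.GrenetZeon.RadicalSplit

variable {m : ℕ}

/-- The separating invariant: `F(X ∧ Y) = tr([X,Y]²)` is an `SL₃`-invariant quadratic form on `Λ² gl₃` and
`F(e ∧ f′) = tr(diag(1,−2,1)²) = 6 ≠ 0` — so `[Irr₃]` is NOT in the nullcone: **Irr₃ is semistable**, while every
triangularisable / G-, G′-, G″-certified space is unstable.  (In)stability separates the two worlds of the dossier.
Kernel datum (decidable arithmetic). -/
theorem irrThree_commutator : irrE * irrF - irrF * irrE = !![1, 0, 0; 0, -2, 0; 0, 0, 1] := by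
  ext i j
  fin_cases i <;> fin_cases j <;> simp [irrE, irrF]
  norm_num

/-- `irrThree_commutator_sq_trace` (val-idea-27, `WeightShadow.lean` @9b27f785c669; ported verbatim). -/
theorem irrThree_commutator_sq_trace : Matrix.trace ((irrE * irrF - irrF * irrE) ^ 2) = 6 := by
  rw [irrThree_commutator, pow_two, Matrix.trace, Fin.sum_univ_three]
  simp
  norm_num

/-- Extraction: members of `wtFilt P lvl d` have conjugate supported on weights `≥ d`. -/
theorem conj_apply_eq_zero_of_mem_wtFilt {P : (Matrix (Fin m) (Fin m) ℂ)ˣ} {lvl : Fin m → ℕ} {d : ℤ}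
    {M : Matrix (Fin m) (Fin m) ℂ} (hM : M ∈ wtFilt P lvl d) :
    ∀ i j : Fin m, wt lvl i j < d → conj P M i j = 0 := by
  induction hM using Submodule.span_induction with
  | mem x hx => exact hx
  | zero => intro i j _; simp [conj]
  | add x y _ _ hx hy =>
      intro i j h
      have e : conj P (x + y) = conj P x + conj P y := by simp [conj, Matrix.mul_add, Matrix.add_mul]
      rw [e, Matrix.add_apply, hx i j h, hy i j h, add_zero]
  | smul a x _ hx =>
      intro i j h
      have e : conj P (a • x) = a • conj P x := by simp [conj]
      rw [e, Matrix.smul_apply, hx i j h, smul_zero]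

/-- **The weight argument behind semistability witnesses (the HM ⇒ direction for the invariant `tr([X,Y]²)`):**
if `X` has `λ`-weights `≥ d` and `Y` has `λ`-weights `≥ d'` with `d + d' ≥ 1`, then `[X, Y]` is conjugate to a matrix
supported on positive weights, so `tr([X,Y]²) = 0`. -/
theorem trace_comm_sq_eq_zero_of_wt (P : (Matrix (Fin m) (Fin m) ℂ)ˣ) (lvl : Fin m → ℕ) {d d' : ℤ}
    (hdd : 1 ≤ d + d') {X Y : Matrix (Fin m) (Fin m) ℂ} (hX : X ∈ wtFilt P lvl d) (hY : Y ∈ wtFilt P lvl d') :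
    Matrix.trace ((X * Y - Y * X) ^ 2) = 0 := by
  have hX' := conj_apply_eq_zero_of_mem_wtFilt hX
  have hY' := conj_apply_eq_zero_of_mem_wtFilt hY
  set C := conj P X * conj P Y - conj P Y * conj P X with hC
  -- `C` vanishes at every position of weight `≤ 0`
  have hCz : ∀ i j : Fin m, lvl i ≤ lvl j → C i j = 0 := by
    intro i j hij
    have h1 : (conj P X * conj P Y) i j = 0 := by
      rw [Matrix.mul_apply]
      apply Finset.sum_eq_zero
      intro k _
      by_cases hk : wt lvl i k < d
      · rw [hX' i k hk, zero_mul]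
      · rw [hY' k j (by simp only [wt] at hk ⊢; omega), mul_zero]
    have h2 : (conj P Y * conj P X) i j = 0 := by
      rw [Matrix.mul_apply]
      apply Finset.sum_eq_zero
      intro k _
      by_cases hk : wt lvl i k < d'
      · rw [hY' i k hk, zero_mul]
      · rw [hX' k j (by simp only [wt] at hk ⊢; omega), mul_zero]
    simp [hC, Matrix.sub_apply, h1, h2]
  have htrC : Matrix.trace (C ^ 2) = 0 := by
    rw [pow_two, Matrix.trace]
    apply Finset.sum_eq_zero
    intro i _
    rw [Matrix.diag_apply, Matrix.mul_apply]
    apply Finset.sum_eq_zero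
    intro j _
    rcases le_or_gt (lvl i) (lvl j) with hij | hij
    · rw [hCz i j hij, zero_mul]
    · rw [hCz j i hij.le, mul_zero]
  have hconj : conj P ((X * Y - Y * X) ^ 2) = C ^ 2 := by
    rw [pow_two, pow_two, conj_mul, conj_sub, conj_mul, conj_mul]
  rw [← trace_conj P, hconj, htrC]

/-- `dim Irr₃ ≤ 2`. -/
theorem finrank_irrThreeSpace_le : Module.finrank ℂ irrThreeSpace ≤ 2 := by
  classical
  have h := finrank_span_finset_le_card (R := ℂ) ({irrE, irrF} : Finset (Matrix (Fin 3) (Fin 3) ℂ))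
  rw [Finset.coe_pair] at h
  exact h.trans Finset.card_le_two

/-- `trace_comm_irrE_sq` (val-idea-27, `WeightShadow.lean` @9b27f785c669; ported verbatim). -/
theorem trace_comm_irrE_sq (y₁ y₂ : ℂ) :
    Matrix.trace ((irrE * (y₁ • irrE + y₂ • irrF) - (y₁ • irrE + y₂ • irrF) * irrE) ^ 2) = 6 * y₂ ^ 2 := by
  have h : irrE * (y₁ • irrE + y₂ • irrF) - (y₁ • irrE + y₂ • irrF) * irrE = y₂ • (irrE * irrF - irrF * irrE) := by
    rw [Matrix.mul_add, Matrix.add_mul, Matrix.mul_smul, Matrix.mul_smul, Matrix.smul_mul, Matrix.smul_mul,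
      smul_sub]
    abel
  rw [h, smul_pow, Matrix.trace_smul, irrThree_commutator_sq_trace, smul_eq_mul]
  ring

/-- `trace_comm_irrF_sq` (val-idea-27, `WeightShadow.lean` @9b27f785c669; ported verbatim). -/
theorem trace_comm_irrF_sq (y₁ y₂ : ℂ) :
    Matrix.trace ((irrF * (y₁ • irrE + y₂ • irrF) - (y₁ • irrE + y₂ • irrF) * irrF) ^ 2) = 6 * y₁ ^ 2 := by
  have h : irrF * (y₁ • irrE + y₂ • irrF) - (y₁ • irrE + y₂ • irrF) * irrF = -(y₁ • (irrE * irrF - irrF * irrE)) := by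
    rw [Matrix.mul_add, Matrix.add_mul, Matrix.mul_smul, Matrix.mul_smul, Matrix.smul_mul, Matrix.smul_mul,
      smul_sub]
    abel
  rw [h, neg_sq, smul_pow, Matrix.trace_smul, irrThree_commutator_sq_trace, smul_eq_mul]
  ring

/-- Key step: if all of `Irr₃` has weights `≥ d`, then no nonzero element of `Irr₃` has weights `≥ d'` when `d + d' ≥ 1`
(else `tr([e,Y]²) = 6y₂²` and `tr([f′,Y]²) = 6y₁²` would vanish). -/
theorem irrThree_eq_zero_of_wt {P : (Matrix (Fin 3) (Fin 3) ℂ)ˣ} {lvl : Fin 3 → ℕ} {d d' : ℤ} (hdd : 1 ≤ d + d')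
    (hW : irrThreeSpace ≤ wtFilt P lvl d) {Y : Matrix (Fin 3) (Fin 3) ℂ} (hY : Y ∈ irrThreeSpace)
    (hYF : Y ∈ wtFilt P lvl d') : Y = 0 := by
  have he : irrE ∈ wtFilt P lvl d := hW (Submodule.subset_span (by simp))
  have hf : irrF ∈ wtFilt P lvl d := hW (Submodule.subset_span (by simp))
  obtain ⟨y₁, y₂, rfl⟩ := Submodule.mem_span_pair.1 hY
  have t1 := trace_comm_sq_eq_zero_of_wt P lvl hdd he hYF
  have t2 := trace_comm_sq_eq_zero_of_wt P lvl hdd hf hYF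
  rw [trace_comm_irrE_sq] at t1
  rw [trace_comm_irrF_sq] at t2
  have hy₂ : y₂ = 0 := by simpa using t1
  have hy₁ : y₁ = 0 := by simpa using t2
  simp [hy₁, hy₂]

/-- **K2 (PROVED v1.5): MOR's `Irr₃` is Plücker-SEMISTABLE** — no cocharacter has positive Plücker degree on it.
Proof: pair the filtration steps `d ↔ 1 − d`; `dim(W ∩ F_d) + dim(W ∩ F_{1−d}) ≤ dim W` for every `d` by
`irrThree_eq_zero_of_wt` (the invariant `tr([X,Y]²)`), and the paired sum is exactly `plDeg`. -/
theorem irrThree_semistable : ¬ PlUnstable irrThreeSpace := by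
  classical
  rintro ⟨P, lvl, p, -, hpos⟩
  have hD2 : (Module.finrank ℂ irrThreeSpace : ℤ) ≤ 2 := by exact_mod_cast finrank_irrThreeSpace_le
  set W := irrThreeSpace with hWdef
  set f : ℤ → ℤ := fun d => (Module.finrank ℂ ↥(W ⊓ wtFilt P lvl d) : ℤ) with hf
  set D : ℤ := (Module.finrank ℂ W : ℤ) with hD
  have f_le : ∀ d, f d ≤ D := by
    intro d; simp only [hf, hD]
    exact_mod_cast Submodule.finrank_mono (inf_le_left : W ⊓ wtFilt P lvl d ≤ W)
  have f_nn : ∀ d, 0 ≤ f d := fun d => by simp only [hf]; positivity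
  -- full rank at `d` forces `W ≤ F_d`
  have full : ∀ d, f d = D → W ≤ wtFilt P lvl d := by
    intro d h
    have h' : Module.finrank ℂ ↥(W ⊓ wtFilt P lvl d) = Module.finrank ℂ W := by
      simp only [hf, hD] at h; exact_mod_cast h
    have := Submodule.eq_of_le_of_finrank_eq (inf_le_left : W ⊓ wtFilt P lvl d ≤ W) h'
    exact inf_eq_left.1 this
  -- the vanishing lemma empties the opposite piece
  have empty : ∀ d d' : ℤ, 1 ≤ d + d' → W ≤ wtFilt P lvl d → f d' = 0 := by
    intro d d' hdd hle
    have hbot : W ⊓ wtFilt P lvl d' = ⊥ := by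
      rw [eq_bot_iff]
      intro Y hY
      rw [Submodule.mem_bot]
      exact irrThree_eq_zero_of_wt hdd hle (Submodule.mem_inf.1 hY).1 (Submodule.mem_inf.1 hY).2
    show (Module.finrank ℂ ↥(W ⊓ wtFilt P lvl d') : ℤ) = 0
    rw [hbot, finrank_bot, Nat.cast_zero]
  have key : ∀ d : ℤ, f d + f (1 - d) ≤ D := by
    intro d
    by_cases h1 : f d = D
    · have := empty d (1 - d) (by omega) (full d h1); rw [this, add_zero]; exact f_le d
    by_cases h2 : f (1 - d) = D
    · have := empty (1 - d) d (by omega) (full (1 - d) h2); rw [this, zero_add]; exact f_le (1 - d)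
    have a1 : f d ≤ D - 1 := by have := f_le d; omega
    have a2 : f (1 - d) ≤ D - 1 := by have := f_le (1 - d); omega
    have := f_nn d
    have := f_nn (1 - d)
    omega
  -- plDeg = Σ_{d=1}^{p} (f d + f (1-d) - D) ≤ 0
  have hre : ∑ d ∈ Finset.Icc (1 - (p : ℤ)) 0, (D - f d) = ∑ d ∈ Finset.Icc (1 : ℤ) p, (D - f (1 - d)) := by
    apply Finset.sum_nbij' (fun d => 1 - d) (fun d => 1 - d)
    · intro a ha; simp only [Finset.mem_Icc] at ha ⊢; omega
    · intro a ha; simp only [Finset.mem_Icc] at ha ⊢; omega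
    · intro a _; ring
    · intro a _; ring
    · intro a _; simp
  have hle : plDeg W P lvl p ≤ 0 := by
    have : plDeg W P lvl p = ∑ d ∈ Finset.Icc (1 : ℤ) p, (f d + f (1 - d) - D) := by
      simp only [plDeg]
      rw [show (∑ d ∈ Finset.Icc (1 - (p : ℤ)) 0,
          ((Module.finrank ℂ W : ℤ) - (Module.finrank ℂ ↥(W ⊓ wtFilt P lvl d) : ℤ))) =
          ∑ d ∈ Finset.Icc (1 - (p : ℤ)) 0, (D - f d) from rfl, hre, ← Finset.sum_sub_distrib]
      apply Finset.sum_congr rfl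
      intro d _
      simp only [hf, hD]
      ring
    rw [this]
    apply Finset.sum_nonpos
    intro d _
    have := key d
    linarith
  exact absurd hpos (not_lt.2 hle)

end Summit.ValiantsHypothesis.ValiantsHypothesis.Theorems.GrenetZeon.WeightShadow

end
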